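import Summits.BirchSwinnertonDyer.BirchSwinnertonDyer.Theses.UniversalToricDescent
import Summits.BirchSwinnertonDyer.BirchSwinnertonDyer.Theorems.UniversalToricDescentTwinWanFrameAtThreeMultTresTAllSplitSelfDual
import Summits.BirchSwinnertonDyer.BirchSwinnertonDyer.Theorems.UniversalToricDescentToricKernelAtThreeDegreeOnlyTwinOfPrint
import HarnessLib

/-!
# SKELETON v16 (line `membertower`; LEAD bsd-wall-utd-p2 g18, 2026-08-28) — crux ♭B′ `TwinWanFrameAtThreeMultTresT`
# (stmt-BirchSwinnertonDyer-27401) and the act-DEG crux of record ♭B′° `TwinDegreeFrameAtThreeMultTresT` (stmt-22539), BY NAME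

v16 = v15 (sha16 64aafdb3a13cf6ca) RE-KEYED onto the repaired (print-faithful) member statements of PEN-RULING-27934-v1, after the
route's R(i) (rev 72: support 22593 ↦ 23284 `TwinCastellaMembersFramesCongruenceOddInput := …_odd_nonsplit_wt`) and the landed S1
kernel† (this lead's `UniversalToricDescentTwinWanFrameAtThreeMultTresTAllSplitSelfDual`, (5)†):

* `stub_thmB` — unchanged (item 20711, Hsieh 2014 Thm B, PUB BY NAME).
* `stub_pubMembersFramesCongruence` := `Castella2018.castella2020_thm211_members_frames_sigma_congruence_odd_nonsplit_wt` (item 23284, PUB BY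
  NAME; p661135/p661053): the weight-sharpened member/frame supply — members chosen with `2(p−1)p^{m−1} ∣ k_m − 2`, a free choice in print
  [Skinner2016 §2.6], so that their SELF-DUAL lattice is congruent to `E[p^m]` [Castella2018Erratum, proof of Thm 1.1 (a)(b)].
* `stub_selfDualMemberRationalInclusionAtThree` := **K1♯†** — the pen's restated K1-at-3 text v2 (`utdK/SketchK1dag.lean` fc46e6da7466964a)
  VERBATIM: depth `m ≥ 1`, weight clause `2(3−1)3^{m−1} ∣ k_m − 2`, residually irreducible members, Selmer side over the SELF-DUAL Tate twist
  `D.Δ.selfDualCofreeRepOver K` (p657158) = the erratum's `A_g` [Castella2018Erratum, §2 p. 2] against the member's Σ-frame (central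
  values). This REPLACES v15's `stub_twoVarCoreAtThree := TV₃` (misstated-by-inheritance: arithmetic-normalised lattice); the two-variable
  form TV₃† (p655790 §1 re-run over `A†`, width seat utd-p2-w2 g9 announced 19:53Z) may replace it again in v17 — TV₃† ⟹ K1♯ᵈ† ⟹ ♭B′.
  K1♯† is RESEARCH: no Eisenstein-side engine in print at `p = 3` (YZ26 weight 2 / good ordinary; FW21 Thm 4.41 needs a non-split `q ∥ N`;
  KLZ17 §7.2 `p ≥ 5`); the YZ26 weight-`k` port work-order (LEAD-NOTE-g16 §2) is unchanged except that its output must be read on `A†`.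

Composition: `TwinWanFrameAtThreeMultTresT_of` := (5)† `…AllSplitSelfDual.twinWanFrameAtThreeMultTresT_of_thmB_of_nonsplitWtMembersFrames_of_selfDualMemberRationalInclusion`
(tower† of utd-p2-w2 g9 over imc-p1's member inputs†; weight clause threaded from the supply to K1♯† verbatim);
`TwinDegreeFrameAtThreeMultTresT_of` := p640116 §4 ∘ it. lean rc 0 expected with exactly 3 sorries (the stubs); both cruxes concluded BY NAME.
Item 27934 itself is still the legacy (untwisted) text, HELD; whether the pen restates it (R(ii)) or files K1♯† as a new item (option δ),
this stub's TEXT is the statement the line needs. BSD is not proved by any of this; every `sorry` below is a stub.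
[cite: Castella2018Erratum, §2 (p. 2), proof of Thm. 1.1 (a)(b)(c)] [cite: Skinner2016PacificMC, §2.6 (2-6-1), §3.1] [cite: Castella2020JIMJ, Thm. 2.11]
[cite: Hsieh2014, Thm. B] [cite: YanZhu2026, Thm. 4.4, Thm. 4.7, Thm. 5.7 (1)]
-/

noncomputable section

open scoped Classical

set_option linter.dupNamespace false
set_option autoImplicit false

namespace Summit.BirchSwinnertonDyer.BirchSwinnertonDyer.Cruxes.TwinWanFrameAtThreeMultTresT.MemberTower

open PowerSeries WeierstrassCurve NumberField IsDedekindDomain Field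
  Literature.NumberTheory.EllipticCurves
  Literature.NumberTheory.EllipticCurves.ModularForms
  Literature.NumberTheory.EllipticCurves.Rank1Residual
  Literature.NumberTheory.EllipticCurves.BigGaloisRep
  Literature.NumberTheory.EllipticCurves.GreenbergSelmer
  Literature.NumberTheory.GaloisRepresentations
  Summit.BirchSwinnertonDyer.Rank1Residual.X11b
  Summit.BirchSwinnertonDyer.Rank1Residual.X11b.Halves
  Summit.BirchSwinnertonDyer.BirchSwinnertonDyer.Theorems.SchneiderFree
  Summit.BirchSwinnertonDyer.BirchSwinnertonDyer.Theorems.UniversalToricDescentTwinTorsionRankOne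
  Summit.BirchSwinnertonDyer.BirchSwinnertonDyer.Theorems.UniversalToricDescentTwinDecLocus
  Summit.BirchSwinnertonDyer.BirchSwinnertonDyer.Theses.UniversalToricDescent

/-- STUB (BY NAME = item stmt-BirchSwinnertonDyer-20711 `TwinHsiehThmBInput`; refereed; closes only by formalisation):
Hsieh 2014 Thm. B at every level — `μ = 0` of the anticyclotomic `p`-adic `L`-function with unramified period.
[cite: Hsieh2014, Thm. B p. 712 (Doc. Math. 19)] -/
theorem stub_thmB : Hsieh2014.thmB_exists_isHsiehLFunction_coeff_norm_eq_one_unrPeriod_anyLevel := by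
  sorry

/-- STUB (BY NAME = item stmt-BirchSwinnertonDyer-23284 `TwinCastellaMembersFramesCongruenceOddInput` at route rev 72, the
weight-sharpened supply 22593†; PUBLISHED by reading; closes only by formalisation): Castella JIMJ 2020 §2 Def. 2.10 / Thm. 2.11 at
an odd prime WITH the erratum's hypothesis (iii), members chosen with `2(p−1)p^{m−1} ∣ k_m − 2` (free in print: Skinner 2016 §2.6).
[cite: Castella2020JIMJ, §2 Def. 2.10, Thm. 2.11] [cite: Castella2018Erratum, Thm. 1.1 (iii), proof (a)(b)] [cite: Skinner2016PacificMC, §2.6 (2-6-1), §3.1] -/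
theorem stub_pubMembersFramesCongruence :
    Castella2018.castella2020_thm211_members_frames_sigma_congruence_odd_nonsplit_wt := by
  sorry

/-- STUB (RESEARCH, v16 = **K1♯†**, hardest stub; the pen's restated K1-at-3 text v2 fc46e6da7466964a VERBATIM). For every twin `W′`
multiplicative at `3` with `ρ̄₃` onto, all-split Heegner `K` of odd discriminant, anticyclotomic `κ` with generator `γ`, degree-one `𝔭 ∣ 3`
with the other slot `𝔭′`, branch-compatible `ι′`: for every depth `m ≥ 1`, every Hida member `D` with `2(3−1)3^{m−1} ∣ k_m − 2` and
`ρ̄` irreducible, `ι′`-compatible, every characterised receptacle `b`, every Σ-frame `(Ω_K ≠ 0, Ω_p ∈ 𝓞_{ℂ₃}ˣ, Q)` of `D.g`: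
`X^Σ_ac(A†_{g_m}; 𝔭′)` torsion ⟹ `∃ e, (3^e)·Ch(X^Σ_ac(A†_{g_m}))·𝓞_{ℂ₃}⟦T⟧ ⊆ (Q)`, with `A†_{g_m} = D.Δ.selfDualCofreeRepOver K` the SELF-DUAL
Tate twist (the erratum's `A_g`). Intended engine: the weight-`k_m` PORT of [YanZhu2026, Thm. 4.4 → 4.7 → 5.7 (1)] at `p = 3`, read on `A†`;
no printed statement at `p = 3`. [cite: Castella2018Erratum, §2 (p. 2), (2.5)] [cite: YanZhu2026, §4.1, Thm. 4.2, Thm. 4.4, Thm. 4.7, Thm. 5.7 (1)]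
[cite: SkinnerUrban2014, Thm. 7.7, Prop. 13.6 (1)] [cite: KingsLoefflerZerbes2017, Thm. B, §7.2] -/
theorem stub_selfDualMemberRationalInclusionAtThree :
    ∀ (W' : WeierstrassCurve ℚ) [W'.IsElliptic] [W'.IsGloballyMinimal] (N' : ℕ) [NeZero N'] (K : Type) [Field K] [NumberField K] (Dt' : Literature.NumberTheory.EllipticCurves.ModularForms.ModularParametrizationData W' N'), Literature.NumberTheory.EllipticCurves.Rank1Residual.Mult W' 3 → W'.HasSurjectiveModNGaloisRep 3 → W'.conductorNorm ℤ = N' → Literature.NumberTheory.EllipticCurves.IsImaginaryQuadratic K → Literature.NumberTheory.EllipticCurves.SatisfiesHeegnerHypothesis N' K → Odd (NumberField.discr K) → ∀ (κ : Literature.NumberTheory.EllipticCurves.ZpExtension K 3), κ.IsAnticyclotomic → ∀ (γ : Field.absoluteGaloisGroup K) [Fact (κ.IsTopGenerator γ)] (𝔭 : IsDedekindDomain.HeightOneSpectrum (NumberField.RingOfIntegers K)), ((3 : ℕ) : NumberField.RingOfIntegers K) ∈ 𝔭.asIdeal → 𝔭.asIdeal.ramificationIdx (NumberField.RingOfIntegers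 ℚ) = 1 → 𝔭.asIdeal.inertiaDeg (NumberField.RingOfIntegers ℚ) = 1 → ∀ (𝔭' : IsDedekindDomain.HeightOneSpectrum (NumberField.RingOfIntegers K)), ((3 : ℕ) : NumberField.RingOfIntegers K) ∈ 𝔭'.asIdeal → 𝔭' ≠ 𝔭 → ∀ (ι' : PadicAlgCl 3 ≃+* ℂ), Summit.BirchSwinnertonDyer.BirchSwinnertonDyer.Theorems.SchneiderFree.BranchInducesPrime 3 ι' 𝔭 → ∀ (m : ℕ), 1 ≤ m → ∀ (D : Literature.NumberTheory.EllipticCurves.Skinner2016.HidaCongruentMember W' 3 m), (2 * (((3 : ℕ) : ℤ) - 1) * ((3 : ℕ) : ℤ) ^ (m - 1)) ∣ D.k - 2 → Literature.NumberTheory.EllipticCurves.SkinnerUrban2014.IsResiduallyIrreducible D.Δ → (∀ x : Literature.NumberTheory.EllipticCurves.ModularForms.coeffField D.g, ι' (D.ι x) = (x : ℂ)) → ∀ (b : Literature.NumberTheory.EllipticCurves.GreenbergSelmer.padicCoeffIntegers D.ι →+* 𝓞_ℂ_[3]), (∀ x, ((b x : 𝓞_ℂ_[3]) : ℂ_[3])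 = algebraMap (PadicAlgCl 3) ℂ_[3] (Literature.NumberTheory.EllipticCurves.GreenbergSelmer.padicCoeffIntegers.toPadicAlgCl D.ι x)) → ∀ (ΩK : ℂ) (Ωp : (𝓞_ℂ_[3])ˣ) (Q : PowerSeries 𝓞_ℂ_[3]), ΩK ≠ 0 → Literature.NumberTheory.EllipticCurves.IsBDPLFunctionWtSigmaInt ι' 𝔭 κ γ D.g (W'.sigmaPlacesFinset 3 K) ΩK ((Ωp : 𝓞_ℂ_[3]) : ℂ_[3]) Q → ∀ [TopologicalSpace (PowerSeries (Literature.NumberTheory.EllipticCurves.GreenbergSelmer.padicCoeffIntegers D.ι))] [ContinuousSMul (PowerSeries (Literature.NumberTheory.EllipticCurves.GreenbergSelmer.padicCoeffIntegers D.ι)) (Literature.NumberTheory.EllipticCurves.BigRepModule (Literature.NumberTheory.EllipticCurves.GreenbergSelmer.padicCoeffIntegers D.ι) 3 (Literature.NumberTheory.EllipticCurves.GreenbergSelmer.Cofree D.Δ.selfDualRep (Literature.NumberTheory.EllipticCurves.GreenbergSelmer.padicCoeffField D.ι)))], Module.IsTorsion (PowerSeries (Literature.NumberTheory.EllipticCurves.GreenbergSelmer.padicCoeffIntegers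 D.ι)) (Literature.NumberTheory.EllipticCurves.BigGaloisRep.XBig κ (D.Δ.selfDualCofreeRepOver K) 𝔭' (↑(W'.sigmaPlacesFinset 3 K))) → ∃ e : ℕ, Ideal.span {(PowerSeries.C ((3 : ℕ) : 𝓞_ℂ_[3]) : PowerSeries 𝓞_ℂ_[3]) ^ e} * (Literature.NumberTheory.EllipticCurves.BigGaloisRep.XBig.charIdeal κ (D.Δ.selfDualCofreeRepOver K) 𝔭' (↑(W'.sigmaPlacesFinset 3 K))).map (PowerSeries.map b) ≤ Ideal.span {Q} := by
  sorry

/-- COMPOSITION (v16): the act-R crux ♭B′ `TwinWanFrameAtThreeMultTresT` (item stmt-BirchSwinnertonDyer-27401) BY NAME from the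
three stubs, through the S1 kernel† (5)† (Hsieh Thm B + `…_odd_nonsplit_wt` + K1♯† ⟹ ♭B′: member data read through the
weight-controlled consumer-minimal `C_min†`, self-dual member tower of utd-p2-w2 g9 over imc-p1's member inputs†, `μ(L) = 0` from
Thm B, (dec) for the twin from the très-ramifié binder). [folklore] -/
theorem TwinWanFrameAtThreeMultTresT_of :
    Summit.BirchSwinnertonDyer.BirchSwinnertonDyer.Theses.UniversalToricDescent.TwinWanFrameAtThreeMultTresT :=
  Summit.BirchSwinnertonDyer.BirchSwinnertonDyer.Theorems.UniversalToricDescentTwinWanFrameAtThreeMultTresTAllSplitSelfDual.twinWanFrameAtThreeMultTresT_of_thmB_of_nonsplitWtMembersFrames_of_selfDualMemberRationalInclusion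
    stub_thmB stub_pubMembersFramesCongruence stub_selfDualMemberRationalInclusionAtThree

/-- COMPOSITION (v16 = v14, act DEG): the degree-only twin crux of record ♭B′° `TwinDegreeFrameAtThreeMultTresT` (item
stmt-BirchSwinnertonDyer-22539) BY NAME, from `TwinWanFrameAtThreeMultTresT_of` and the landed monotonicity ♭B′ ⟹ ♭B′°
(`UniversalToricDescentKernelDegreeOnlyTwinOfPrint.twinDegreeFrameMultTresT_of_wanFrame`, p640116 §4). [folklore] -/
theorem TwinDegreeFrameAtThreeMultTresT_of :
    Summit.BirchSwinnertonDyer.BirchSwinnertonDyer.Theses.UniversalToricDescent.TwinDegreeFrameAtThreeMultTresT :=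
  Summit.BirchSwinnertonDyer.BirchSwinnertonDyer.Theorems.UniversalToricDescentKernelDegreeOnlyTwinOfPrint.twinDegreeFrameMultTresT_of_wanFrame
    TwinWanFrameAtThreeMultTresT_of

end Summit.BirchSwinnertonDyer.BirchSwinnertonDyer.Cruxes.TwinWanFrameAtThreeMultTresT.MemberTower

end
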